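import Mathlib
import HarnessLib
import Summits.HubbardSuperconductivity.HubbardSuperconductivity.Theorems.KLProgrammeKLRegimeEngineTowerBlockZeroBaseWtKlEng

/-!
# Route `KLProgramme` — crux K3 ENGINE (stmt-HubbardSuperconductivity-20437 `KLRegimeEngineV17F2`), stub (b), THE WEIGHTED CONJUNCT «(b)-WT4»:
# THE WT4 LAW's BASE DATUM WITH THE BLOCK-`0` WEIGHTED DECAY ROWS DISCHARGED (cell gate-hubbard-kl, seat gate-hubbard-kl-p3 g22, «WT-BASE» file WB3;
# continuation of `baseLawWtF_blockZero_klEng` (…TowerBlockZeroBaseWtKlEng, p700691))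

`baseLawWtF_blockZero_klEng` keeps the `klScaleWt j_r`-weighted decay rows of the block-`0` slice `S(F̃_0)ᵀ·C^{K}_{(Λ_d,Λ_1]}·S(F̃_0)` as hypotheses («αʷ-BLOCK0»).
They ARE in the tree, for every admissible frame and EVERY rate: `exists_alphaWt_sliceCT_fatZero_unif d` (…TowerBlockZeroLinkDataFKlEng §1, over k3c2's
`exists_alphaWt_sliceCT_fatZero`) — `≤ (M/β)·D·(1+ΣGfr)⁴` under `R.WF`, `|U| ≤ 1`, `(n_β+1)U² ≤ 1/2`, `FrameOK`; the three side conditions follow from the doors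
`c ≤ klEngC₃6`, `U ≤ klEngU₀9` exactly as in `linkDataBlockZeroF_klEng` (`abs_le_one_of_le_klEngU₀3`, `nScales_succ_mul_sq_le`, `div_log_four_le_half_of_door`).

* §1 **`alphaWt_blockZero_of_doors (d R)`** — `∃ Cα > 0`: under the doors, for every `FrameOK` frame, `1 ≤ j ≤ d` and every rate `r`, the weighted rows and columns of
  the block-`0` slice `(Λ_j, Λ_1]` at `F̃_0` are `≤ Cα·(M/β)`.
* §2 **`baseLawWtF_blockZero_klEng_closed (d R c″)`** — `baseLawWtF_blockZero_klEng` with those rows DISCHARGED (`ᾱ := Cα·M/β` by an equational binder) and the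
  binder `U ≤ min (klEngU₀3 P R c) (1/(R.Gfr 3+1))` DERIVED from `U ≤ klEngU₀9 P R c`: the WT4 law's base datum `klTowerMeasWtAt … (K_n) d 1 j_r (2p) / klLevUnitF β M 0 p (d−1)
  ≤ A_tot·λ^{p−1}·Q_tot^p` (`p ≥ 3`) is now modulo the level-`0` weighted datum rows and the numerics ONLY — the same input classes as the (ℓ) levels clause.
Compositions of landed theorems; nothing about the model is asserted beyond them; nothing asserts (b), WT4, (ℓ), any stub, K3 or superconductivity.
References: BGM 2006 §2.8 (2.81)–(2.84), (2.93)–(2.98) [cite: BenfattoGiulianiMastropietro2006].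
-/

noncomputable section

namespace Summit.HubbardSuperconductivity.HubbardSuperconductivity.Theorems.EngineV8

set_option linter.dupNamespace false -- summit = problem name (single-conjunct summit), D-0017

open Classical
open Real Finset Literature.MathematicalPhysics.QuantumLattice Literature.Probability.LatticeModels GrassmannAlgebra
open Literature.MathematicalPhysics.QuantumLattice.FermiRG
open Summit.HubbardSuperconductivity.HubbardSuperconductivity.Theorems.KLProgrammeLegKernels
open Summit.HubbardSuperconductivity.HubbardSuperconductivity.Theorems.KLRegimeSplit
open Summit.HubbardSuperconductivity.HubbardSuperconductivity.Theorems.KLRegimeWick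
open Summit.HubbardSuperconductivity.HubbardSuperconductivity.Theorems.TwoPointAssembly
open Summit.HubbardSuperconductivity.HubbardSuperconductivity.Theorems.TorusFourierL2
open Summit.HubbardSuperconductivity.HubbardSuperconductivity.Theorems.DispersionFlow
open Summit.HubbardSuperconductivity.HubbardSuperconductivity.Theorems.TwoVolumeSource
open Summit.HubbardSuperconductivity.HubbardSuperconductivity.Theorems.ScaleZeroDecay
open Literature.Probability.LatticeModels.BattleFederbush

variable {L M : ℕ} [NeZero L] [NeZero M]

/-! ## §1 The block-`0` weighted decay rows from the doors, every frame, every rate -/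

omit [NeZero L] [NeZero M] in
/-- **«αʷ-BLOCK0» FROM THE DOORS**: one `Cα = Cα(d, R) > 0` such that, under `R.WF2`, `0 < c ≤ klEngC₃6`, `0 < U ≤ klEngU₀9`, the β-regime, `FrameOK R U n_β μ K`,
`klEngL₃ ≤ L`, `klEngM₃ ≤ M`, for every `1 ≤ j ≤ d` and EVERY rate `r` the `klScaleWt r`-weighted rows and columns of `S(F̃_0[K])ᵀ·C^{K}_{(Λ_j,Λ_1]}·S(F̃_0[K])` are
`≤ Cα·(M/β)`. [cite: BenfattoGiulianiMastropietro2006, §2.8 (2.81), §3 (3.3)] -/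
theorem alphaWt_blockZero_of_doors (d : ℕ) (R : RenConsts) :
    ∃ Cα : ℝ, 0 < Cα ∧ ∀ (P : SplitConsts) (c : ℝ), R.WF2 → 0 < c → c ≤ klEngC₃6 P R →
      ∀ U : ℝ, 0 < U → U ≤ klEngU₀9 P R c → ∀ β : ℝ, klBetaMin ≤ β → β ≤ Real.exp (c / U ^ 2) →
      ∀ (μ : ℝ) (K : TrigPolyC4v), FrameOK R U (nScales β) μ K → ∀ (L M : ℕ) [NeZero L] [NeZero M], klEngL₃ β U ≤ L → klEngM₃ β U L ≤ M →
      ∀ j : ℕ, 1 ≤ j → j ≤ d → ∀ r : ℕ,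
      (∀ Y, ∑ Y', ‖((sectorSubMatrix L M β (bgmFatMultiplier L M klE0 β (nambuXiCT L μ K) 0)).transpose *
          hubbardCovSliceCT L M β μ 0 K (klScale klE0 j) (klScale klE0 1) * sectorSubMatrix L M β (bgmFatMultiplier L M klE0 β (nambuXiCT L μ K) 0)) Y Y'‖ *
          klScaleWt L M β r {latticeLegPos (2 * (2 * M)) Y, latticeLegPos (2 * (2 * M)) Y'} ≤ Cα * ((M : ℝ) / β)) ∧
      (∀ Y', ∑ Y, ‖((sectorSubMatrix L M β (bgmFatMultiplier L M klE0 β (nambuXiCT L μ K) 0)).transpose *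
          hubbardCovSliceCT L M β μ 0 K (klScale klE0 j) (klScale klE0 1) * sectorSubMatrix L M β (bgmFatMultiplier L M klE0 β (nambuXiCT L μ K) 0)) Y Y'‖ *
          klScaleWt L M β r {latticeLegPos (2 * (2 * M)) Y, latticeLegPos (2 * (2 * M)) Y'} ≤ Cα * ((M : ℝ) / β)) := by
  obtain ⟨D, hD1, hD⟩ := exists_alphaWt_sliceCT_fatZero_unif d
  have hD0 : 0 ≤ D := zero_le_one.trans hD1
  refine ⟨D * ((1 + R.Gfr 0 + R.Gfr 1 + R.Gfr 2 + R.Gfr 3) ^ 4 + 1), by positivity, ?_⟩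
  intro P c hR2 hc hc6 U hU hU9 β hβmin hβc μ K hfr L M _ _ hL3 hM3 j hj1 hjd r
  have hU3 : U ≤ klEngU₀3 P R c := hU9.trans (klEngU₀9_le_klEngU₀3 P R c)
  have hU1 : |U| ≤ 1 := abs_le_one_of_le_klEngU₀3 hU hU3
  have hcD : c ≤ klE4C₃ R := hc6.trans (klEngC₃6_le_klE4C₃ P R)
  have hN : (((nScales β : ℕ) : ℝ) + 1) * U ^ 2 ≤ 1 / 2 :=
    (nScales_succ_mul_sq_le (U := U) hc.le hβmin hβc).trans (div_log_four_le_half_of_door hcD)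
  obtain ⟨hrow, hcol⟩ := hD j hj1 hjd R U μ β (nScales β) K hR2.wf hU1 hN hfr hβmin L M hL3 hM3 r
  have hβ : 0 < β := KLRegimeSplit.pos_of_klBetaMin_le hβmin
  have hMβ : 0 ≤ (M : ℝ) / β := by positivity
  have hle : (M : ℝ) / β * (D * (1 + R.Gfr 0 + R.Gfr 1 + R.Gfr 2 + R.Gfr 3) ^ 4) ≤
      D * ((1 + R.Gfr 0 + R.Gfr 1 + R.Gfr 2 + R.Gfr 3) ^ 4 + 1) * ((M : ℝ) / β) := by
    rw [mul_comm]
    refine mul_le_mul_of_nonneg_right ?_ hMβ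
    rw [mul_add, mul_one]
    linarith
  exact ⟨fun Y => (hrow Y).trans hle, fun Y' => (hcol Y').trans hle⟩

/-! ## §2 The WT4 law's base datum with «αʷ-BLOCK0» discharged -/

/-- **THE WT4 LAW's BASE DATUM ON THE FLOW FRAME, BLOCK-`0` DECAY ROWS DISCHARGED** — `baseLawWtF_blockZero_klEng` ∘ `alphaWt_blockZero_of_doors` at
`(j, r) := (d, j_r)`, `α := Cα·M/β`, `ᾱ := Cα·M/β` (so `α ≤ 4ᾱ`), and `U ≤ min (klEngU₀3 P R c) (1/(R.Gfr 3+1))` derived from `U ≤ klEngU₀9 P R c`; same conclusion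
`klTowerMeasWtAt … (K_n) d 1 j_r (2p) / klLevUnitF β M 0 p (d−1) ≤ A_tot·λ^{p−1}·Q_tot^p` for every `p ≥ 3`.
[cite: BenfattoGiulianiMastropietro2006, §2.8 (2.82)-(2.84), (2.93)-(2.98), Lemma 2.5 (2.98)] -/
theorem baseLawWtF_blockZero_klEng_closed (d : ℕ) (R : RenConsts) (c'' : ℝ) (hc'' : 0 < c'') :
    ∃ Cinc Dinc : ℝ, 1 ≤ Cinc ∧ 1 ≤ Dinc ∧ ∃ Cκ CJ Cα : ℝ, 0 < Cκ ∧ 0 < CJ ∧ 0 < Cα ∧ (R.WF2 → ∃ c₃' : ℝ, 0 < c₃' ∧ ∃ U₀' : ℝ, 0 < U₀' ∧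
      ∀ (G : GeoConsts) (P : SplitConsts) (Q : EngConsts) (c : ℝ), P.WF → 0 < c → c ≤ klEngC₃6 P R → c ≤ c₃' →
      ∀ μ ∈ klWindowC, ∀ U : ℝ, 0 < U → U ≤ klEngU₀9 P R c → U ≤ U₀' → c'' * U ≤ 1 →
      ∀ β : ℝ, klBetaMin ≤ β → β ≤ Real.exp (c / U ^ 2) →
      ∀ (L M : ℕ) [NeZero L] [NeZero M], klEngL₃ β U ≤ L → klEngM₃ β U L ≤ M →
      ∀ n : ℕ, 1 ≤ n → n ≤ nScales β + 1 → IsKLRegime U c (-(n : ℤ)) →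
        HistP klPredsV17F2 L M G P Q R β U μ 0 n → FrameOK R U (nScales β) μ (klFlowFrameU L M β U μ n) →
        (∀ m, 1 ≤ m → m < n → FlowPieceOscAt L M c'' β U μ m) →
      2 ≤ d → d ≤ n → hubbardEffPartitionFnCT L M β U μ 0 (klFlowFrameU L M β U μ n) (klScale klE0 1) ≠ 0 →
      ∀ jr D : ℕ, d - 1 ≤ jr → Fintype.card (SpaceTimeIdx L M × SectorLeg (sectorCount 0)) / 2 ≤ D →
      ∀ (lam Ab Qb : ℝ), 0 < lam → 0 ≤ Ab → 0 ≤ Qb →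
      -- the decay name `ᾱ := Cα·M/β`, the pins and the kit names (equational binders)
      ∀ (αb κb crb ccb W Z σ τ ψ Φ : ℝ), αb = Cα * ((M : ℝ) / β) → κb = Real.sqrt (2 * Cκ * klE0) → crb = 81 * CJ * M / β → ccb = 162 * CJ * M / β →
        W = 32 * crb / ccb → Z = imagTimeWeight β M ^ 2 * ccb ^ 2 / 8 → σ = κb ^ 2 / ccb ^ 2 → τ = 4 * exp 4 * κb ^ 2 / ccb ^ 2 →
        ψ = ccb ^ 2 / κb ^ 2 → Φ = exp 1 * αb * ccb / (κb ^ 2 * crb) →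
      ∀ (A' Q' ι₁ ι₂ ι₃ : ℝ), 0 ≤ A' → 0 < Q' →
      -- the level-`0` weighted datum: its unit law at `(F_0, rate j_r)`, `p ≥ 3`
      (∀ p : ℕ, 3 ≤ p → klTowerMeasWtAt L M β U μ (klFlowFrameU L M β U μ n) 1 1 jr (2 * p) / klLevUnitF β M 0 p 0 ≤ Ab * lam ^ (p - 1) * Qb ^ p) →
      -- its Chernoff / import rows in the kit's scaled array, at `λ`
      (∀ m, 4 ≤ m → m ≤ D → W * Z ^ m * (klTowerMeasWtAt L M β U μ (klFlowFrameU L M β U μ n) 1 1 jr (2 * m) / klLevUnitF β M 0 m 0) ≤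
          A' * lam ^ (m - 1) * Q' ^ m) →
      W * Z ^ 3 * (klTowerMeasWtAt L M β U μ (klFlowFrameU L M β U μ n) 1 1 jr (2 * 3) / klLevUnitF β M 0 3 0) ≤ ι₃ * lam ^ 2 →
      W * Z ^ 1 * (klTowerMeasWtAt L M β U μ (klFlowFrameU L M β U μ n) 1 1 jr (2 * 1) / klLevUnitF β M 0 1 0) ≤ ι₁ * lam →
      W * Z ^ 2 * (klTowerMeasWtAt L M β U μ (klFlowFrameU L M β U μ n) 1 1 jr (2 * 2) / klLevUnitF β M 0 2 0) ≤ ι₂ * lam →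
      -- the five smallness rows and the block-`0` kit guard
      4 * σ * lam * Q' < 1 → 2 * lam * τ * Q' ≤ 1 → exp 1 * τ * lam * Q' < 1 →
      Φ * (τ * (ι₁ * lam + ι₂ / (2 * Q') + ι₃ / (4 * Q' ^ 2) + A' * Q' / 4)) < 1 →
      Φ * (exp 1 * τ * (ι₁ * lam) + (exp 1 * τ) ^ 2 * (ι₂ * lam) + (exp 1 * τ) ^ 3 * (ι₃ * lam ^ 2) +
        A' * (exp 1 * τ * Q') * ((exp 1 * τ * lam * Q') ^ 3 / (1 - exp 1 * τ * lam * Q'))) < 1 →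
      Φ * towerV D τ (fun m => W * Z ^ m * (klTowerMeasWtAt L M β U μ (klFlowFrameU L M β U μ n) 1 1 jr (2 * m) / klLevUnitF β M 0 m 0)) < 1 →
      -- the read-out constants (equational binders)
      ∀ (Aro Qro Qtot Atot : ℝ), Aro = Cinc * Ab → Qro = Dinc * Qb → Qtot = Dinc * max 1 (max Qro (max (4 * Q') (2 * τ * ψ * Q'))) →
        Atot = Aro + Cinc * (A' * (4 * σ * lam * Q' / (1 - 4 * σ * lam * Q')) +
          exp 1 * (τ * (ι₁ * lam + ι₂ / (2 * Q') + ι₃ / (4 * Q' ^ 2) + A' * Q' / 4)) *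
            (Φ * (τ * (ι₁ * lam + ι₂ / (2 * Q') + ι₃ / (4 * Q' ^ 2) + A' * Q' / 4)) /
              (1 - Φ * (τ * (ι₁ * lam + ι₂ / (2 * Q') + ι₃ / (4 * Q' ^ 2) + A' * Q' / 4)))) / (2 * τ * Q')) →
      ∀ p : ℕ, 3 ≤ p →
        klTowerMeasWtAt L M β U μ (klFlowFrameU L M β U μ n) d 1 jr (2 * p) / klLevUnitF β M 0 p (d - 1) ≤ Atot * lam ^ (p - 1) * Qtot ^ p)
  := by
  obtain ⟨Cinc, Dinc, hCinc, hDinc, Cκ, CJ, hCκ, hCJ, hW2⟩ := baseLawWtF_blockZero_klEng d R c'' hc''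
  obtain ⟨Cα, hCα, hA⟩ := alphaWt_blockZero_of_doors d R
  refine ⟨Cinc, Dinc, hCinc, hDinc, Cκ, CJ, Cα, hCκ, hCJ, hCα, fun hR2 => ?_⟩
  obtain ⟨c₃', hc₃', U₀', hU₀', h⟩ := hW2 hR2
  refine ⟨c₃', hc₃', U₀', hU₀', ?_⟩
  intro G P Q c hP hc hc6 hc₃'c μ hμ U hU hU9 hU₀'U hcU β hβmin hβc L M _ _ hL3 hM3 n hn1 hnN hkl hhist hK hosc hd hdn hZ1 jr D hjr hD
    lam Ab Qb hlam hAb hQb αb κb crb ccb W Z σ τ ψ Φ hαb hκb hcrb hccb hW hZ hσ hτ hψ hΦ A' Q' ι₁ ι₂ ι₃ hA'0 hQ'0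
    hlawb hprof hprof3 himp₁ himp₂ hx₁ hx₂ hx₃ hy hθ hguard Aro Qro Qtot Atot hAro hQro hQtot hAtot p hp
  have hU3g : U ≤ min (klEngU₀3 P R c) (1 / (R.Gfr 3 + 1)) :=
    le_min (hU9.trans (klEngU₀9_le_klEngU₀3 P R c)) (hU9.trans (klEngU₀9_le_inv_gfr_add_one P hR2.wf c (by norm_num)))
  obtain ⟨hrow, hcol⟩ := hA P c hR2 hc hc6 U hU hU9 β hβmin hβc μ (klFlowFrameU L M β U μ n) hK L M hL3 hM3 d (by omega) le_rfl jr
  have hβ : 0 < β := KLRegimeSplit.pos_of_klBetaMin_le hβmin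
  have hM0 : (0 : ℝ) < M := Nat.cast_pos.2 (Nat.pos_of_ne_zero (NeZero.ne M))
  have hαb0 : 0 < αb := by rw [hαb]; positivity
  have hααb : Cα * ((M : ℝ) / β) ≤ αb * 4 := by rw [← hαb]; linarith
  exact h G P Q c hP hc hc6 hc₃'c μ hμ U hU hU9 hU3g hU₀'U hcU β hβmin hβc L M hL3 hM3 n hn1 hnN hkl hhist hK hosc hd hdn hZ1 jr D hjr hD
    lam Ab Qb hlam hAb hQb (Cα * ((M : ℝ) / β)) αb hαb0 hααb hrow hcol κb crb ccb W Z σ τ ψ Φ hκb hcrb hccb hW hZ hσ hτ hψ hΦ A' Q' ι₁ ι₂ ι₃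
    hA'0 hQ'0 hlawb hprof hprof3 himp₁ himp₂ hx₁ hx₂ hx₃ hy hθ hguard Aro Qro Qtot Atot hAro hQro hQtot hAtot p hp

end Summit.HubbardSuperconductivity.HubbardSuperconductivity.Theorems.EngineV8

end
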